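import Mathlib.Topology.Instances.Shrink
import Literature.Topology.FourManifolds.SmoothPoincareLowDim
import Literature.Topology.FourManifolds.HCobordism
import Literature.Topology.FourManifolds.HCobordantOfDiffeomorph
import Literature.Topology.FourManifolds.HomotopySpheresGroup
import Literature.Topology.FourManifolds.SmoothOrientationProofs
import Literature.Topology.FourManifolds.GluckTwistMeridian
import Literature.Topology.FourManifolds.ManifoldULift
import HarnessLib

/-!
# spc4.S32 in the language of `Θₙ`: the smooth Poincaré conjecture in dimensions `1, 2, 3, 5, 6, 12, 56, 61` from its leaves

Topic `Literature/Topology/FourManifolds`, sibling of `SPC4Wave0.lean` (the named fact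
`Literature.Topology.FourManifolds.nonemptyDiffeomorphSphere_of_mem`, spc4.S32: every Hausdorff
second countable smooth `n`-manifold homotopy equivalent to `𝕊ⁿ` is diffeomorphic to `𝕊ⁿ` for
`n ∈ {1, 2, 3, 5, 6, 12, 56, 61}`) and of `SmoothPoincareLowDim.lean` (its leaves in dimensions
`1, 2, 3`). spc4.S32 is an omnibus of eight theorems with five different sources; this file makes
its trust base explicit and **proves** the assembly, WITHOUT introducing any new named fact:

* dimension `1`: classification of curves (`nonemptyDiffeomorphSphere_one`, `SmoothPoincareLowDim.lean`;
  Milnor, *Topology from the differentiable viewpoint*, Appendix);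
* dimension `2`: classification of surfaces (`nonemptyDiffeomorphSphere_two`; Kervaire–Milnor p. 507,
  Hirsch Ch. 9 Thm. 3.5);
* dimension `3`: Perelman (`nonempty_diffeomorph_sphere_three`, spc4.S31; Morgan–Tian 2007, Cor. 0.2 (a));
* dimensions `5, 6, 12, 56, 61`: `Θₙ = 0`, i.e. every homotopy `n`-sphere is h-cobordant to `Sⁿ`
  — Kervaire–Milnor, *Groups of homotopy spheres I*, Ann. of Math. 77 (1963), table p. 504
  (`|Θ₅| = |Θ₆| = |Θ₁₂| = 1`), printed with proofs in Kosinski, *Differential Manifolds* (1993),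
  Ch. X §6: "`θ⁴ = θ⁵ = 0`" (p. 217), "`θ⁸ = 𝐙₂, θ¹² = 0, θ¹⁶ = 𝐙₂`" (p. 218), "`θ⁶ = 0, θ¹³ = 𝐙₃,
  θ¹⁴ = 𝐙₂`" (p. 219); Isaksen, *Stable stems*, Mem. AMS 262 (2019) for dimension `56`, as recorded
  in Wang–Xu, Thm. 1.14: "(Isaksen) The sphere `S⁵⁶` has a unique smooth structure"; Wang–Xu, Ann. of
  Math. 186 (2017), Thm. 1.9: "The 2-primary `π₆₁ = 0`, and therefore the sphere `S⁶¹` has a unique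
  smooth structure" (arXiv:1601.02184 numbering; Cor. 1.15 there: "For `5 ≤ n ≤ 61`, the only
  dimensions that `Sⁿ` has a unique smooth structure are `n = 5, 6, 12, 56` and `61`"; likewise
  Isaksen–Wang–Xu, *More stable stems*, arXiv:2001.04511, p. 8: "Uniqueness in dimensions 5, 6 and
  12 was known to Kervaire and Milnor. Uniqueness in dimension 56 is due to [Isaksen], and
  uniqueness in dimension 61 is due to [Wang–Xu]") — TOGETHER WITH Smale's h-cobordism theorem
  (`nonempty_diffeomorph_of_isHCobordant_of_five_le`, spc4.S15, `HCobordism.lean`), by which `Θₙ`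
  "can be identified for `m ≥ 5` with the group of smooth structures on the topological
  `m`-spheres" (Kosinski VIII (5.5)–(5.6), pp. 159–160; Wang–Xu Thm. 1.7: "The group `Θₙ` classifies the
  differential structures on `Sⁿ` for `n ≥ 5`"; Kervaire–Milnor §1).

## Main statements (all proved)

* `nonemptyDiffeomorphSphere_of_univ_zero`, `nonemptyDiffeomorphSphere_univ_zero_of`,
  `nonemptyDiffeomorphSphere_of_mem_univ_iff` — **universe invariance**: the smooth Poincaré
  statement in dimension `n` for all `M : Type` is equivalent to the one for all `M : Type u`
  (Hausdorff second countable spaces are small; `C^∞` structures are transported along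
  `Shrink.homeomorph`, resp. lifted to `ULift`).
* `forall_nonemptyDiffeomorphSphere_iff_subsingleton` — for `n ≥ 2`, **the smooth Poincaré
  conjecture in dimension `n` holds iff `Θₙ = HomotopySphereClass n` (oriented homotopy `n`-spheres
  modulo orientation-preserving diffeomorphism, `HomotopySpheres.lean`) is a point**: a smooth
  manifold `≃ₕ 𝕊ⁿ` is compact (`compactSpace_of_homotopyEquiv_sphere`), simply connected and hence
  orientable (`isOrientable_of_simplyConnectedSpace_holds`, Lee Thm. 15.43), so it is the carrier of
  a homotopy sphere, whose class equals `[𝕊ⁿ, o₀]`; conversely `subsingleton_of_nonempty_diffeomorph_sphere`.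
* `forall_nonemptyDiffeomorphSphere_of_isHCobordant_sphere`,
  `isHCobordant_sphere_of_forall_nonemptyDiffeomorphSphere` — for `n ≥ 5` and GIVEN spc4.S15, the
  dimension-`n` statement is equivalent to Kervaire–Milnor's **`Θₙ = 0` in h-cobordism form**:
  every closed smooth `n`-manifold `≃ₕ 𝕊ⁿ` is h-cobordant (`Literature.Topology.FourManifolds.IsHCobordant`)
  to `𝕊ⁿ` (Kervaire–Milnor p. 505).
* `nonemptyDiffeomorphSphere_of_mem_of_leaves` — **spc4.S32 (every universe) from its leaves**:
  dimensions `1, 2` (`nonemptyDiffeomorphSphere_one/two`), `3` (spc4.S31), `Θₙ = 0` in h-cobordism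
  form for `n ∈ {5, 6, 12, 56, 61}` (hypothesis `hΘ`, the five cited computations) and spc4.S15.
* `nonemptyDiffeomorphSphere_of_mem_iff_subsingleton` — **spc4.S32 ⟺ (dimension `1`) ∧
  (`Θₙ` is a point for `n ∈ {2, 3, 5, 6, 12, 56, 61}`)**, unconditionally.

## Not here

No named fact is introduced (D-0026): the five computations `Θ₅ = Θ₆ = Θ₁₂ = 0` (Kervaire–Milnor),
`Θ₅₆ = 0` (Isaksen), `Θ₆₁ = 0` (Wang–Xu) enter as the explicit hypothesis `hΘ`; their proofs
(surgery below the middle dimension, the `J`-homomorphism, the Adams spectral sequence through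
the `61`-stem) are far beyond the tree. The discharge `nonemptyDiffeomorphSphere_of_mem_holds`
therefore remains open; its exact residue is displayed by `nonemptyDiffeomorphSphere_of_mem_iff_subsingleton`.
Dimension `1` is kept in the spc4.S32 shape (not `Θ₁`) because packaging a curve as an oriented
homotopy sphere needs the orientability of `1`-manifolds, which the tree does not have
(`OneManifoldCircle.lean` classifies ORIENTED compact curves; accordingly `Θ₁ = 0` itself is
already the theorem `HomotopySphereClass.subsingleton_one` of `HomotopySpheresGroupDimOne.lean`,
while `nonemptyDiffeomorphSphere_one` remains a named fact).

## References

* M. Kervaire, J. Milnor, *Groups of homotopy spheres I*, Ann. of Math. (2) 77 (1963), 504–537: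
  table p. 504, §1, §2 p. 507 (not held; page loci as recorded in `HomotopySpheres.lean`,
  `HCobordism.lean`). [KervaireMilnorAnnals1963]
* A. A. Kosinski, *Differential Manifolds*, Pure Appl. Math. 138, Academic Press (1993), VIII
  (5.5)–(5.6) pp. 159–160, X §6 pp. 217–219 (held; PDF pp. 127, 175–177). [Kosinski1993]
* G. Wang, Z. Xu, *The triviality of the 61-stem in the stable homotopy groups of spheres*, Ann. of
  Math. (2) 186 (2017), 501–580; arXiv:1601.02184, Thms. 1.3, 1.7, 1.9, 1.14, Cor. 1.13, 1.15,
  Conj. 1.17. [WangXu2017]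
* D. C. Isaksen, *Stable stems*, Mem. Amer. Math. Soc. 262 (2019), no. 1269; arXiv:1407.8418. [Isaksen2019]
* S. Smale, *On the structure of manifolds*, Amer. J. Math. 84 (1962), Thm. 1.1, Cor. 1.3. [Smale1962]
* J. Milnor, *Lectures on the h-cobordism theorem* (1965), Thm. 9.1. [MilnorHCobordism1965]
* J. Morgan, G. Tian, *Ricci flow and the Poincaré conjecture* (2007), Cor. 0.2 (a). [MorganTian2007]
* J. M. Lee, *Introduction to Smooth Manifolds*, 2nd ed. (2013), Thm. 15.43. [LeeSmoothManifolds2013]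
-/

noncomputable section

open ContinuousMap
open scoped Manifold ContDiff Topology ContinuousMap

namespace Literature.Topology.FourManifolds

universe u

/-- Local notation: `𝔼 n` is the model Euclidean space `EuclideanSpace ℝ (Fin n)`. -/
local notation "𝔼 " n:arg => EuclideanSpace ℝ (Fin n)

/-- Local notation: `𝕊 n` is the unit sphere in `EuclideanSpace ℝ (Fin (n + 1))`, the standard
`n`-sphere with its Mathlib analytic manifold structure. -/
local notation "𝕊 " n:arg => (Metric.sphere (0 : EuclideanSpace ℝ (Fin (n + 1))) 1)

/-! ### Universe invariance of the smooth Poincaré statement -/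

/-- **Universe lift.** If every Hausdorff second countable smooth `n`-manifold `M : Type` homotopy
equivalent to `𝕊ⁿ` is diffeomorphic to `𝕊ⁿ`, the same holds for every `M : Type u`: `M` is small
(`small_of_secondCountableTopology`), its `C^∞` structure is transported to `Shrink.{0} M : Type`
along `φ = Shrink.homeomorph M` (`Homeomorph.transportChartedSpace`,
`Homeomorph.isManifold_transportChartedSpace`), `φ` becomes a diffeomorphism
(`Homeomorph.transportDiffeomorph`), and a diffeomorphism `Shrink.{0} M ≅ 𝕊ⁿ` is pulled back along
it. [folklore] -/
theorem nonemptyDiffeomorphSphere_of_univ_zero {n : ℕ}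
    (h : ∀ (M : Type) [TopologicalSpace M] [T2Space M] [SecondCountableTopology M],
      ContinuousMap.HomotopyEquiv.NonemptyDiffeomorphSphere M n)
    (M : Type u) [TopologicalSpace M] [T2Space M] [SecondCountableTopology M] :
    ContinuousMap.HomotopyEquiv.NonemptyDiffeomorphSphere M n := by
  intro _ _ e
  haveI : Small.{0} M := small_of_secondCountableTopology M
  let φ : M ≃ₜ Shrink.{0} M := Shrink.homeomorph M
  letI : ChartedSpace (𝔼 n) (Shrink.{0} M) := Homeomorph.transportChartedSpace φ
  haveI : IsManifold (𝓡 n) ∞ (Shrink.{0} M) :=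
    Homeomorph.isManifold_transportChartedSpace (I₀ := 𝓡 n) (n := ∞) φ
  haveI : T2Space (Shrink.{0} M) := φ.t2Space
  haveI : SecondCountableTopology (Shrink.{0} M) := φ.symm.secondCountableTopology
  obtain ⟨f⟩ := h (Shrink.{0} M) inferInstance inferInstance (φ.symm.toHomotopyEquiv.trans e)
  exact ⟨(Homeomorph.transportDiffeomorph (I₀ := 𝓡 n) (n := ∞) φ).trans f⟩

/-- **Universe restriction.** If every Hausdorff second countable smooth `n`-manifold `M : Type u`
homotopy equivalent to `𝕊ⁿ` is diffeomorphic to `𝕊ⁿ`, the same holds for every `M : Type`: apply the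
hypothesis to `ULift.{u} M` with its lifted `C^∞` structure (`ManifoldULift.lean`) and compose with
the canonical diffeomorphism `ULift M ≅ M` (`ManifoldULift.diffeomorph`). [folklore] -/
theorem nonemptyDiffeomorphSphere_univ_zero_of {n : ℕ}
    (h : ∀ (M : Type u) [TopologicalSpace M] [T2Space M] [SecondCountableTopology M],
      ContinuousMap.HomotopyEquiv.NonemptyDiffeomorphSphere M n)
    (M : Type) [TopologicalSpace M] [T2Space M] [SecondCountableTopology M] :
    ContinuousMap.HomotopyEquiv.NonemptyDiffeomorphSphere M n := by
  intro _ _ e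
  obtain ⟨f⟩ := h (ULift.{u} M) inferInstance inferInstance
    (Homeomorph.ulift.toHomotopyEquiv.trans e)
  exact ⟨(ManifoldULift.diffeomorph (𝓡 n) M ∞).symm.trans f⟩

/-- **Universe invariance of the smooth Poincaré statement in dimension `n`**: it holds for all
Hausdorff second countable `M : Type u` iff it holds for all such `M : Type`. [folklore] -/
theorem forall_nonemptyDiffeomorphSphere_univ_iff {n : ℕ} :
    (∀ (M : Type u) [TopologicalSpace M] [T2Space M] [SecondCountableTopology M],
      ContinuousMap.HomotopyEquiv.NonemptyDiffeomorphSphere M n) ↔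
    ∀ (M : Type) [TopologicalSpace M] [T2Space M] [SecondCountableTopology M],
      ContinuousMap.HomotopyEquiv.NonemptyDiffeomorphSphere M n :=
  ⟨fun h M _ _ _ => nonemptyDiffeomorphSphere_univ_zero_of h M,
    fun h M _ _ _ => nonemptyDiffeomorphSphere_of_univ_zero h M⟩

/-- **spc4.S32 is universe invariant**: `nonemptyDiffeomorphSphere_of_mem.{u}` is equivalent to
`nonemptyDiffeomorphSphere_of_mem.{0}` (dimension by dimension, `forall_nonemptyDiffeomorphSphere_univ_iff`).
[folklore] -/
theorem nonemptyDiffeomorphSphere_of_mem_univ_iff :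
    nonemptyDiffeomorphSphere_of_mem.{u} ↔ nonemptyDiffeomorphSphere_of_mem.{0} :=
  ⟨fun h n hn M _ _ _ => nonemptyDiffeomorphSphere_univ_zero_of (h n hn) M,
    fun h n hn M _ _ _ => nonemptyDiffeomorphSphere_of_univ_zero (h n hn) M⟩

/-! ### The smooth Poincaré statement in dimension `n ≥ 2` and `Θₙ` -/

/-- **If every homotopy `n`-sphere is standard then `Θₙ` is a point** (`n ≠ 0`): the smooth
Poincaré statement in dimension `n` (for all Hausdorff second countable `M : Type`) gives a
diffeomorphism `Σ ≅ 𝕊ⁿ` for every oriented homotopy sphere `Σ`, and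
`HomotopySphereClass.subsingleton_of_nonempty_diffeomorph_sphere` (a diffeomorphism out of the
connected `Σ` preserves or reverses the orientations, and `[𝕊ⁿ, o] = [𝕊ⁿ, -o]`) concludes.
Kervaire–Milnor 1963, p. 507 (`Θ₁ = Θ₂ = 0`, `Θ₃` modulo the Poincaré hypothesis).
[cite: KervaireMilnorAnnals1963, §2 p. 507] -/
theorem subsingleton_homotopySphereClass_of_forall {n : ℕ} (hn : n ≠ 0)
    (h : ∀ (M : Type) [TopologicalSpace M] [T2Space M] [SecondCountableTopology M],
      ContinuousMap.HomotopyEquiv.NonemptyDiffeomorphSphere M n) :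
    Subsingleton (HomotopySphereClass n) := by
  refine HomotopySphereClass.subsingleton_of_nonempty_diffeomorph_sphere hn fun S => ?_
  obtain ⟨e⟩ := S.nonempty_homotopyEquiv
  exact h S.carrier S.chartedSpace S.isManifold e

/-- **If `Θₙ` is a point then every homotopy `n`-sphere is standard** (`n ≥ 2`). A Hausdorff
second countable smooth `n`-manifold `M` homotopy equivalent to `𝕊ⁿ` is compact
(`compactSpace_of_homotopyEquiv_sphere`: `Hₙ(Sⁿ) ≠ 0` while a non-compact connected `n`-manifold
has `Hₙ = 0`, Hatcher Prop. 3.29), simply connected (`π₁(Sⁿ) = 1` for `n ≥ 2`,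
`simplyConnectedSpace_euclideanSphere`, and homotopy invariance) and therefore orientable
(`isOrientable_of_simplyConnectedSpace_holds`, Lee Thm. 15.43); with any orientation it is an
oriented homotopy sphere `Σ`, and `[Σ] = [𝕊ⁿ, o₀]` in the one-point `Θₙ` yields an
(orientation-preserving) diffeomorphism `M ≅ 𝕊ⁿ` (`HomotopySphereClass.exact`). This is the
reading of "`Θₙ = 0`" as "every homotopy `n`-sphere is diffeomorphic to `Sⁿ`" (Kervaire–Milnor
1963, §1; Kosinski VIII (5.5)–(5.6), pp. 159–160). [cite: KervaireMilnorAnnals1963, §1] [cite: Kosinski1993, VIII (5.5)–(5.6) pp. 159–160] -/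
theorem forall_nonemptyDiffeomorphSphere_of_subsingleton {n : ℕ} (hn : 2 ≤ n)
    [Subsingleton (HomotopySphereClass n)] :
    ∀ (M : Type) [TopologicalSpace M] [T2Space M] [SecondCountableTopology M],
      ContinuousMap.HomotopyEquiv.NonemptyDiffeomorphSphere M n := by
  intro M _ _ _ _ _ e
  haveI : CompactSpace M := compactSpace_of_homotopyEquiv_sphere (n := n) (by omega) M e
  haveI := simplyConnectedSpace_euclideanSphere (n := n) hn
  haveI : SimplyConnectedSpace M := e.simplyConnectedSpace
  obtain ⟨o⟩ := (isOrientable_of_simplyConnectedSpace_holds (I := 𝓡 n) (M := M) :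
    Nonempty (SmoothOrientation (𝓡 n) M))
  obtain ⟨o₀⟩ := (isOrientable_sphere_holds n : Nonempty (SmoothOrientation (𝓡 n) (𝕊 n)))
  obtain ⟨φ, -⟩ := HomotopySphereClass.exact
    (Subsingleton.elim (HomotopySphereClass.mk ⟨M, o, ⟨e⟩⟩)
      (HomotopySphereClass.mk (HomotopySphere.sphere o₀)))
  exact ⟨φ⟩

/-- **The smooth Poincaré conjecture in dimension `n ≥ 2` holds iff `Θₙ` is a point**
(`Θₙ = HomotopySphereClass n`, oriented homotopy `n`-spheres modulo orientation-preserving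
diffeomorphism; Kervaire–Milnor 1963, §1, and p. 507 for `n ≤ 3`). Both directions are theorems
of the tree (`subsingleton_homotopySphereClass_of_forall`,
`forall_nonemptyDiffeomorphSphere_of_subsingleton`). [cite: KervaireMilnorAnnals1963, §1 and §2 p. 507] -/
theorem forall_nonemptyDiffeomorphSphere_iff_subsingleton {n : ℕ} (hn : 2 ≤ n) :
    (∀ (M : Type) [TopologicalSpace M] [T2Space M] [SecondCountableTopology M],
      ContinuousMap.HomotopyEquiv.NonemptyDiffeomorphSphere M n) ↔
    Subsingleton (HomotopySphereClass n) :=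
  ⟨subsingleton_homotopySphereClass_of_forall (by omega),
    fun _ => forall_nonemptyDiffeomorphSphere_of_subsingleton hn⟩

/-! ### Kervaire–Milnor's h-cobordism form of `Θₙ = 0` (`n ≥ 5`) -/

/-- **`Θₙ = 0` in h-cobordism form implies the smooth Poincaré statement in dimension `n ≥ 5`,
GIVEN Smale's h-cobordism theorem** (spc4.S15, `nonempty_diffeomorph_of_isHCobordant_of_five_le`):
if every closed smooth `n`-manifold homotopy equivalent to `𝕊ⁿ` is h-cobordant to `𝕊ⁿ`
(Kervaire–Milnor's `Θₙ`, the group of h-cobordism classes of homotopy `n`-spheres, is trivial;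
*Groups of homotopy spheres I* (1963), §1), then every Hausdorff second countable smooth
`n`-manifold `M ≃ₕ 𝕊ⁿ` is diffeomorphic to `𝕊ⁿ`: `M` is compact (`compactSpace_of_homotopyEquiv_sphere`)
and simply connected (`simplyConnectedSpace_euclideanSphere`), so the h-cobordism to `𝕊ⁿ` is a
product by Smale's theorem. Kosinski, *Differential Manifolds*, VIII (5.5)–(5.6), pp. 159–160: `θᵐ`
"can be identified for `m ≥ 5` with the group of smooth structures on the topological
`m`-spheres"; Wang–Xu 2017, Thm. 1.7: "The group `Θₙ` classifies the differential structures on `Sⁿ`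
for `n ≥ 5`". [cite: Kosinski1993, VIII (5.5)–(5.6) pp. 159–160] [cite: Smale1962, Thm. 1.1 and Cor. 1.3] -/
theorem forall_nonemptyDiffeomorphSphere_of_isHCobordant_sphere {n : ℕ} (hn : 5 ≤ n)
    (hS15 : nonempty_diffeomorph_of_isHCobordant_of_five_le.{0})
    (hΘ : ∀ (M : Type) [TopologicalSpace M] [T2Space M] [SecondCountableTopology M]
      [ChartedSpace (𝔼 n) M] [IsManifold (𝓡 n) ∞ M] [CompactSpace M],
      M ≃ₕ 𝕊 n → IsHCobordant n M (𝕊 n)) :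
    ∀ (M : Type) [TopologicalSpace M] [T2Space M] [SecondCountableTopology M],
      ContinuousMap.HomotopyEquiv.NonemptyDiffeomorphSphere M n := by
  intro M _ _ _ _ _ e
  haveI : CompactSpace M := compactSpace_of_homotopyEquiv_sphere (n := n) (by omega) M e
  haveI := simplyConnectedSpace_euclideanSphere (n := n) (by omega)
  haveI : SimplyConnectedSpace M := e.simplyConnectedSpace
  exact hS15 hn (hΘ M e)

/-- **The smooth Poincaré statement in dimension `n` implies `Θₙ = 0` in h-cobordism form**:
a closed smooth `n`-manifold `M ≃ₕ 𝕊ⁿ` is then diffeomorphic to `𝕊ⁿ`, hence h-cobordant to it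
(`isHCobordant_of_diffeomorph`: Kervaire–Milnor 1963, §1, "the relation of h-cobordism … is
implied by diffeomorphism"). In particular the hypothesis `hΘ` of
`forall_nonemptyDiffeomorphSphere_of_isHCobordant_sphere` is not stronger than its conclusion.
[cite: KervaireMilnorAnnals1963, §1] -/
theorem isHCobordant_sphere_of_forall_nonemptyDiffeomorphSphere {n : ℕ}
    (h : ∀ (M : Type) [TopologicalSpace M] [T2Space M] [SecondCountableTopology M],
      ContinuousMap.HomotopyEquiv.NonemptyDiffeomorphSphere M n)
    (M : Type) [TopologicalSpace M] [T2Space M] [SecondCountableTopology M]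
    [ChartedSpace (𝔼 n) M] [IsManifold (𝓡 n) ∞ M] [CompactSpace M] (e : M ≃ₕ 𝕊 n) :
    IsHCobordant n M (𝕊 n) := by
  obtain ⟨φ⟩ := h M ‹_› ‹_› e
  exact isHCobordant_of_diffeomorph φ

/-! ### spc4.S32 from its leaves -/

/-- **spc4.S32 from its leaves, at every universe.** The smooth Poincaré conjecture in dimensions
`n ∈ {1, 2, 3, 5, 6, 12, 56, 61}` (`nonemptyDiffeomorphSphere_of_mem`) follows from:
(dimension `1`) the classification of curves (`nonemptyDiffeomorphSphere_one`; Milnor, *Topology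
from the differentiable viewpoint*, Appendix); (dimension `2`) the classification of surfaces
(`nonemptyDiffeomorphSphere_two`; Kervaire–Milnor p. 507, Hirsch Ch. 9 Thm. 3.5); (dimension `3`)
Perelman's theorem (`nonempty_diffeomorph_sphere_three`, spc4.S31; Morgan–Tian 2007, Cor. 0.2 (a)),
via `nonemptyDiffeomorphSphere_three_of`; (dimensions `5, 6, 12, 56, 61`) `Θₙ = 0` in h-cobordism
form — hypothesis `hΘ`: every closed smooth `n`-manifold `≃ₕ 𝕊ⁿ` is h-cobordant to `𝕊ⁿ`; sources:
Kervaire–Milnor 1963, table p. 504 (`|Θ₅| = |Θ₆| = |Θ₁₂| = 1`), printed with proofs in Kosinski,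
*Differential Manifolds* (1993), X §6, pp. 217–219 ("`θ⁴ = θ⁵ = 0`", "`θ¹² = 0`", "`θ⁶ = 0`");
Isaksen, *Stable stems* (2019) for `n = 56` (Wang–Xu Thm. 1.14: "(Isaksen) The sphere `S⁵⁶` has a
unique smooth structure"); Wang–Xu 2017, Thm. 1.9 for `n = 61` ("The 2-primary `π₆₁ = 0`, and
therefore the sphere `S⁶¹` has a unique smooth structure"); summarised in Wang–Xu Cor. 1.15 —
together with Smale's h-cobordism theorem (`nonempty_diffeomorph_of_isHCobordant_of_five_le`,
spc4.S15), via `forall_nonemptyDiffeomorphSphere_of_isHCobordant_sphere`; and the universe lift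
`nonemptyDiffeomorphSphere_of_univ_zero`.
[cite: KervaireMilnorAnnals1963, table p. 504 and §2 p. 507] [cite: Kosinski1993, X §6 pp. 217–219] [cite: WangXu2017, Thm. 1.9, Thm. 1.14, Cor. 1.15 (arXiv numbering)] [cite: Isaksen2019, stem 56 (attribution via WangXu2017 Thm. 1.14)] [cite: MorganTian2007, Cor. 0.2 (a)] -/
theorem nonemptyDiffeomorphSphere_of_mem_of_leaves
    (h1 : nonemptyDiffeomorphSphere_one.{0}) (h2 : nonemptyDiffeomorphSphere_two.{0})
    (h3 : nonempty_diffeomorph_sphere_three.{0})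
    (hS15 : nonempty_diffeomorph_of_isHCobordant_of_five_le.{0})
    (hΘ : ∀ n ∈ ({5, 6, 12, 56, 61} : Set ℕ), ∀ (M : Type) [TopologicalSpace M] [T2Space M]
      [SecondCountableTopology M] [ChartedSpace (𝔼 n) M] [IsManifold (𝓡 n) ∞ M] [CompactSpace M],
      M ≃ₕ 𝕊 n → IsHCobordant n M (𝕊 n)) :
    nonemptyDiffeomorphSphere_of_mem.{u} := by
  intro n hn M _ _ _
  refine nonemptyDiffeomorphSphere_of_univ_zero (n := n) ?_ M
  simp only [Set.mem_insert_iff, Set.mem_singleton_iff] at hn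
  rcases hn with rfl | rfl | rfl | hn
  · exact h1
  · exact h2
  · exact fun M _ _ _ => nonemptyDiffeomorphSphere_three_of h3 M
  · rcases hn with rfl | rfl | rfl | rfl | rfl <;>
      exact forall_nonemptyDiffeomorphSphere_of_isHCobordant_sphere (by norm_num) hS15
        (hΘ _ (by simp))

/-! ### spc4.S32 in the language of `Θₙ` -/

/-- **spc4.S32 implies that `Θₙ` is a point for every `n ∈ {1, 2, 3, 5, 6, 12, 56, 61}`**
(`subsingleton_homotopySphereClass_of_forall`, after restricting spc4.S32 to universe `0`;
Kervaire–Milnor 1963, table p. 504 and p. 507). [cite: KervaireMilnorAnnals1963, table p. 504 and §2 p. 507] -/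
theorem subsingleton_homotopySphereClass_of_mem (h : nonemptyDiffeomorphSphere_of_mem.{u}) :
    ∀ n ∈ ({1, 2, 3, 5, 6, 12, 56, 61} : Set ℕ), Subsingleton (HomotopySphereClass n) := by
  intro n hn
  have hn0 : n ≠ 0 := by
    rintro rfl
    simp at hn
  exact subsingleton_homotopySphereClass_of_forall hn0
    fun M _ _ _ => nonemptyDiffeomorphSphere_univ_zero_of (h n hn) M

/-- **spc4.S32 (every universe) from the dimension-`1` leaf and the triviality of `Θₙ` for
`n ∈ {2, 3, 5, 6, 12, 56, 61}`** (`forall_nonemptyDiffeomorphSphere_of_subsingleton` and the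
universe lift). Sources for the hypotheses: Kervaire–Milnor 1963, p. 507 (`Θ₂ = 0`; `Θ₃ = 0` given
the Poincaré hypothesis, now Perelman) and table p. 504 (`Θ₅ = Θ₆ = Θ₁₂ = 0`; Kosinski X §6,
pp. 217–219); Isaksen 2019 (`Θ₅₆ = 0`, Wang–Xu Thm. 1.14); Wang–Xu 2017, Thm. 1.9 (`Θ₆₁ = 0`).
[cite: KervaireMilnorAnnals1963, table p. 504 and §2 p. 507] [cite: Kosinski1993, X §6 pp. 217–219] [cite: WangXu2017, Thm. 1.9, Thm. 1.14 (arXiv numbering)] -/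
theorem nonemptyDiffeomorphSphere_of_mem_of_subsingleton (h1 : nonemptyDiffeomorphSphere_one.{0})
    (hΘ : ∀ n ∈ ({2, 3, 5, 6, 12, 56, 61} : Set ℕ), Subsingleton (HomotopySphereClass n)) :
    nonemptyDiffeomorphSphere_of_mem.{u} := by
  intro n hn M _ _ _
  refine nonemptyDiffeomorphSphere_of_univ_zero (n := n) ?_ M
  simp only [Set.mem_insert_iff, Set.mem_singleton_iff] at hn
  rcases hn with rfl | hn
  · exact h1
  · have h2 : 2 ≤ n := by
      rcases hn with rfl | rfl | rfl | rfl | rfl | rfl | rfl <;> norm_num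
    haveI : Subsingleton (HomotopySphereClass n) :=
      hΘ n (by simp only [Set.mem_insert_iff, Set.mem_singleton_iff]; tauto)
    exact forall_nonemptyDiffeomorphSphere_of_subsingleton h2

/-- **spc4.S32 ⟺ (smooth Poincaré in dimension `1`) ∧ (`Θₙ` is a point for
`n ∈ {2, 3, 5, 6, 12, 56, 61}`)**, at every universe and unconditionally: the exact residue of
the named fact `nonemptyDiffeomorphSphere_of_mem` in the language of Kervaire–Milnor's `Θₙ`
(as oriented-diffeomorphism classes, `HomotopySphereClass`). Kervaire–Milnor 1963, table p. 504 and
p. 507; Wang–Xu 2017, Cor. 1.15.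
[cite: KervaireMilnorAnnals1963, table p. 504 and §2 p. 507] [cite: WangXu2017, Cor. 1.15 (arXiv numbering)] -/
theorem nonemptyDiffeomorphSphere_of_mem_iff_subsingleton :
    nonemptyDiffeomorphSphere_of_mem.{u} ↔
      nonemptyDiffeomorphSphere_one.{0} ∧
        ∀ n ∈ ({2, 3, 5, 6, 12, 56, 61} : Set ℕ), Subsingleton (HomotopySphereClass n) := by
  refine ⟨fun h => ⟨?_, fun n hn => ?_⟩,
    fun h => nonemptyDiffeomorphSphere_of_mem_of_subsingleton h.1 h.2⟩
  · exact nonemptyDiffeomorphSphere_one_of_mem (nonemptyDiffeomorphSphere_of_mem_univ_iff.mp h)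
  · refine subsingleton_homotopySphereClass_of_mem h n ?_
    simp only [Set.mem_insert_iff, Set.mem_singleton_iff] at hn ⊢
    tauto

end Literature.Topology.FourManifolds

end
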